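import Summits.QuantumAdvantage.QuantumAdvantage.Theorems.LinnikCubicClassGroupsDegreeOnePrimesEscapeQuinticA5Closure
import Mathlib.FieldTheory.Normal.Closure
import Mathlib.FieldTheory.Galois.Basic
import Mathlib.Algebra.Group.End
import Mathlib.GroupTheory.Perm.Fin
import Mathlib.GroupTheory.SpecificGroups.Alternating
import HarnessLib

/-!
# The `A₄`-closure of an `A₄`-quartic field: `Gal(N/ℚ) ↪ Perm (Fin 4)` with image `A₄`

Topic `Summits/QuantumAdvantage/QuantumAdvantage/Theorems`, cell B2b-1 (linnik-cubic), PART A (gen 8);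
helper toward the crux `DegreeOnePrimesEscape` (stmt-QuantumAdvantage-11543) of route
`LinnikCubicClassGroups`.  HONEST FRAMING: the value of this file is a THEOREM (kernel-checked field
theory) — NOT summit progress.

Let `K` be a quartic number field and `N/ℚ` a Galois number field of degree `12` GENERATED by the
embedded copies of `K` (`⨆_f f(K) = ⊤`; i.e. `N` is a Galois closure of `K` and `K` is an "`A₄`-quartic").
Then `G = Gal(N/ℚ)` acts faithfully on the four embeddings `K → N`; numbering them with `f₀ ↦ 0` gives
an injective `ψ : G →* Perm (Fin 4)` whose image — a subgroup of index `2` — is the alternating group,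
with `Gal(N/f₀K) = ψ⁻¹ Stab(0)`; and `|d_N| ≤ |d_K|^{12}`.  (`quarticA4Closure`; the quintic analogue is
`…QuinticA5Closure.lean`.)
-/

noncomputable section

open scoped NumberField
open Literature.NumberTheory.LFunctions Literature.NumberTheory.LFunctions.NumberField

namespace Summit.QuantumAdvantage.QuantumAdvantage.Theorems.DegreeOnePrimesEscape

set_option maxHeartbeats 400000 in
/-- **The `A₄`-closure of an `A₄`-quartic field.** Let `K` be a quartic number field and `N` a Galois
number field of degree `12` generated by the embedded copies of `K`.  Then there are an embedded copy
`K' ≅ K` and an injective `ψ : Gal(N/ℚ) →* Perm (Fin 4)` with image the even permutations, under which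
`Gal(N/K')` corresponds to the stabiliser of `0`; and `|d_N| ≤ |d_K|^{12}`. -/
theorem quarticA4Closure (K : Type) [Field K] [NumberField K] (hK : Module.finrank ℚ K = 4)
    (N : Type) [Field N] [NumberField N] [IsGalois ℚ N] (hN : Module.finrank ℚ N = 12)
    (hgen : ⨆ f : K →ₐ[ℚ] N, f.fieldRange = ⊤) :
    ∃ (K' : IntermediateField ℚ N) (_ : K ≃ₐ[ℚ] K') (ψ : (N ≃ₐ[ℚ] N) →* Equiv.Perm (Fin 4)),
      Function.Injective ψ ∧ (∀ q : Equiv.Perm (Fin 4), q ∈ ψ.range ↔ Equiv.Perm.sign q = 1) ∧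
      (∀ g : N ≃ₐ[ℚ] N, g ∈ K'.fixingSubgroup ↔ ψ g 0 = 0) ∧
      (NumberField.discr N).natAbs ≤ (NumberField.discr K).natAbs ^ 12 := by
  classical
  have hsep : ∀ s : N ≃ₐ[ℚ] N, s ≠ 1 → ∃ f : K →ₐ[ℚ] N, s ∉ f.fieldRange.fixingSubgroup :=
    fun s hs => separating_of_iSup_fieldRange_eq_top hgen s hs
  have hG : Nat.card (N ≃ₐ[ℚ] N) = 12 := by rw [IsGalois.card_aut_eq_finrank, hN]
  -- an embedding exists since the copies generate `⊤ ≠ ⊥`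
  have hEmb_ne : Nonempty (K →ₐ[ℚ] N) := by
    by_contra h
    rw [not_nonempty_iff] at h
    have : (⨆ f : K →ₐ[ℚ] N, f.fieldRange) = ⊥ := iSup_of_empty _
    rw [hgen] at this
    have h1 : Module.finrank ℚ (⊤ : IntermediateField ℚ N) = Module.finrank ℚ (⊥ : IntermediateField ℚ N) := by
      rw [this]
    rw [IntermediateField.finrank_top', IntermediateField.finrank_bot, hN] at h1
    omega
  obtain ⟨f₀⟩ := hEmb_ne
  -- the action of `G` on the embeddings `K → N`
  let ψ₀ : (N ≃ₐ[ℚ] N) →* Equiv.Perm (K →ₐ[ℚ] N) :=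
    { toFun := fun s => ⟨fun f => s.toAlgHom.comp f, fun f => s.symm.toAlgHom.comp f,
        fun f => by ext x; simp, fun f => by ext x; simp⟩
      map_one' := by ext f x; rfl
      map_mul' := fun s t => by ext f x; rfl }
  have hψ₀ : ∀ (s : N ≃ₐ[ℚ] N) (f : K →ₐ[ℚ] N) (x : K), ψ₀ s f x = s (f x) := fun s f x => rfl
  have hinj : Function.Injective ψ₀ := by
    intro s t hst
    by_contra hne
    have hne1 : t⁻¹ * s ≠ 1 := fun h1 => hne (by
      have h2 := congrArg (t * ·) h1
      simpa using h2)
    obtain ⟨f, hf⟩ := hsep _ hne1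
    apply hf
    rw [IntermediateField.mem_fixingSubgroup_iff]
    rintro _ ⟨x, rfl⟩
    have hx : s (f x) = t (f x) := by
      rw [← hψ₀ s f x, ← hψ₀ t f x, hst]
    show (t⁻¹ * s) (f x) = f x
    rw [AlgEquiv.mul_apply, hx, AlgEquiv.aut_inv, AlgEquiv.symm_apply_apply]
  -- exactly `4` embeddings
  have hEmb_le : Fintype.card (K →ₐ[ℚ] N) ≤ 4 := by
    rw [← Nat.card_eq_fintype_card, ← hK]; exact card_algHom_le_finrank ℚ K N
  have hPerm : Nat.card (N ≃ₐ[ℚ] N) ≤ Nat.card (Equiv.Perm (K →ₐ[ℚ] N)) :=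
    Nat.card_le_card_of_injective ψ₀ hinj
  rw [hG, Nat.card_eq_fintype_card, Fintype.card_perm] at hPerm
  have hEmb : Fintype.card (K →ₐ[ℚ] N) = 4 := by
    by_contra hne
    have hlt : Fintype.card (K →ₐ[ℚ] N) ≤ 3 := by omega
    have := Nat.factorial_le hlt
    have h6 : Nat.factorial 3 = 6 := rfl
    omega
  -- number the embeddings with `f₀ ↦ 0`
  let e₁ : (K →ₐ[ℚ] N) ≃ Fin 4 := Fintype.equivFinOfCardEq hEmb
  let e : (K →ₐ[ℚ] N) ≃ Fin 4 := e₁.trans (Equiv.swap (e₁ f₀) 0)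
  have he : e f₀ = 0 := by simp [e, Equiv.swap_apply_left]
  let ψ : (N ≃ₐ[ℚ] N) →* Equiv.Perm (Fin 4) := e.permCongrHom.toMonoidHom.comp ψ₀
  have hψ : ∀ g, ψ g = e.permCongr (ψ₀ g) := fun g => rfl
  have hψinj : Function.Injective ψ := e.permCongrHom.injective.comp hinj
  -- the image has index `2`, hence is `A₄`
  have hrange : ψ.range = alternatingGroup (Fin 4) := by
    apply Equiv.Perm.eq_alternatingGroup_of_index_eq_two
    have hcard : Nat.card ψ.range = 12 := by
      rw [← hG]; exact (Nat.card_congr (MonoidHom.ofInjective hψinj).toEquiv).symm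
    have h := ψ.range.card_mul_index
    rw [hcard, Nat.card_eq_fintype_card, Fintype.card_perm, Fintype.card_fin] at h
    have h24 : Nat.factorial 4 = 24 := rfl
    omega
  have hstab : ∀ g : N ≃ₐ[ℚ] N, g ∈ f₀.fieldRange.fixingSubgroup ↔ ψ g 0 = 0 := by
    intro g
    have h1 : ψ g 0 = e (ψ₀ g (e.symm 0)) := rfl
    have h2 : e.symm 0 = f₀ := by rw [← he, Equiv.symm_apply_apply]
    rw [h1, h2, ← he, e.apply_eq_iff_eq, IntermediateField.mem_fixingSubgroup_iff]
    constructor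
    · intro h
      ext x
      rw [hψ₀]
      exact h _ ⟨x, rfl⟩
    · intro h
      rintro _ ⟨x, rfl⟩
      have h3 : ψ₀ g f₀ x = f₀ x := congrArg (fun φ : K →ₐ[ℚ] N => φ x) h
      rw [hψ₀] at h3
      exact h3
  have hdisc : (NumberField.discr N).natAbs ≤ (NumberField.discr K).natAbs ^ 12 :=
    hN ▸ natAbs_discr_le_pow_of_separating K N hsep
  refine ⟨f₀.fieldRange, f₀.equivFieldRange, ψ, hψinj, fun q => ?_, hstab, hdisc⟩
  rw [hrange, Equiv.Perm.mem_alternatingGroup]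

end Summit.QuantumAdvantage.QuantumAdvantage.Theorems.DegreeOnePrimesEscape

end
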